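import Summits.Parity.BatemanHorn.Theorems.SoloInformedPolySegmentSieve
import Summits.Parity.BatemanHorn.Theorems.SoloInformedErdosNairWeights

/-!
# Erdős's bound `∑_{n ≤ N} τ(|g(n)|) ≪ N log N`: Shiu's class I for polynomial values

Solo informed line (Parity / Bateman–Horn), session 139 — third file of the unconditional proof of
Erdős's bound (discharging the Nair–Tenenbaum hypothesis of `SoloInformedErdosUpperBoundNT`).  With
`m_n = |g(n)| = c_n d_n` cut at height `z` (`c_n = Shiu.cPart z m_n ≤ z`, cut prime
`P_n = Shiu.cutPrime z m_n`, every prime of `d_n` at least `P_n`), class I consists of the `n ≤ N`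
with `m_n > z` and `P_n > w`.  Uniformly in `g` with `ρ_g(p) ≤ D`, `ρ_g(p) < p`, `ρ_g(p^a) ≤ W`
(`ρ_g = polyRootCountMod ![g]`):
* `card_divisors_le_two_pow_bigOmega`, `card_divisors_le_two_pow_of_rough` — `τ(d) ≤ 2^{Ω(d)} ≤ 2^M`
  for `d ≤ X` free of primes `< w`, `log X / log w ≤ M`;
* `dvd_and_sifted_of_cPart_eq` — the fibre `{c_n = c}` of class I lies in the sifted polynomial
  progression `{n : c ∣ g(n), p ∤ g(n) (p < w, p ∤ c)}` of `polySegment_sieve_bound'`;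
* `polyClassI_bound` — **class I**: `τ(m_n) = τ(c)τ(d_n) ≤ τ(c) 2^M`, the fibres are counted by
  `polySegment_sieve_bound'` and the weights `τ(c)ρ_g(c)∏_{p∣c}(1 − ρ_g(p)/p)⁻¹/c` summed by
  `exists_weightSum_le`:
  `∑_I τ(m_n) ≤ 2^M K ((N + z) ∏_{p<w}(1 − ρ_g(p)/p) + w² z) (∏_{p ≤ ⌊z⌋}(1 − ρ_g(p)/p))⁻²`.
Everything is PROVED; no definitions, no named facts.  Small values and class II:
`SoloInformedErdosNairClassII`; classes III–IV and the assembly follow.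

References: P. Shiu, J. reine angew. Math. 313 (1980) 161–170, §5 [Shiu1980]; M. Nair, Acta Arith.
62 (1992) 257–269 [Nair1992]; P. Erdős, J. London Math. Soc. 27 (1952) 7–15 [Erdos1952].
-/

open Finset Real Polynomial

namespace Summit.Parity.BatemanHorn.Theorems

open Literature.NumberTheory.Sieve

namespace ErdosDivisor


/-! ### `τ(d) ≤ 2^{Ω(d)}` -/

/-- `τ(p^l) = l + 1 ≤ 2^l`. [folklore] -/
theorem card_divisors_prime_pow_le_two_pow {p : ℕ} (hp : p.Prime) (l : ℕ) :
    (#(p ^ l).divisors : ℝ) ≤ 2 ^ l := by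
  rw [Nat.divisors_prime_pow hp, card_map, card_range]
  exact_mod_cast Nat.lt_two_pow_self

/-- `τ(d) ≤ 2^{Ω(d)}` for `d ≠ 0` (`τ` is multiplicative with `τ(p^l) = l + 1 ≤ 2^l`;
`Shiu.le_pow_bigOmega`). [folklore] -/
theorem card_divisors_le_two_pow_bigOmega {d : ℕ} (hd : d ≠ 0) :
    (#d.divisors : ℝ) ≤ 2 ^ Shiu.bigOmega d :=
  Shiu.le_pow_bigOmega (f := fun n : ℕ => (#n.divisors : ℝ)) (fun _ => Nat.cast_nonneg _)
    (by simp) (fun m n hmn => by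
      show (#(m * n).divisors : ℝ) = #m.divisors * #n.divisors
      rw [Nat.Coprime.card_divisors_mul hmn, Nat.cast_mul])
    (fun p l hp _ => card_divisors_prime_pow_le_two_pow hp l) hd

/-- In class I the rough cofactor has few divisors: if every prime factor of `d ≠ 0` is `≥ w > 1`,
`d ≤ X` and `log X / log w ≤ M`, then `τ(d) ≤ 2^M`. [cite: Shiu1980, §5 (∑_I)] -/
theorem card_divisors_le_two_pow_of_rough {d : ℕ} (hd : d ≠ 0) {w X : ℝ} (hw : 1 < w)
    (h : ∀ p ∈ d.primeFactors, w ≤ (p : ℝ)) (hX : (d : ℝ) ≤ X) {M : ℕ}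
    (hM : Real.log X / Real.log w ≤ M) : (#d.divisors : ℝ) ≤ 2 ^ M := by
  have hΩ := Shiu.bigOmega_le_div_log hd hw h hX
  have hΩM : Shiu.bigOmega d ≤ M := by exact_mod_cast hΩ.trans hM
  exact (card_divisors_le_two_pow_bigOmega hd).trans (pow_le_pow_right₀ one_le_two hΩM)

/-! ### The decomposition `|g(n)| = c_n d_n` -/

/-- `z < m` with `z ≥ 1` forces `m ≥ 2`. [folklore] -/
theorem two_le_natAbs_of_lt {z : ℝ} (hz : 1 ≤ z) {m : ℕ} (hzm : z < (m : ℝ)) : 2 ≤ m := by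
  have : (1 : ℝ) < m := lt_of_le_of_lt hz hzm
  exact_mod_cast this

/-- If `c_n = c` (the cut of `m = |g(n)|` at height `z`) and the cut prime exceeds `u`, then `c ∣ g(n)`
and no prime `p < u` with `p ∤ c` divides `g(n)` (such a `p` would divide `d_n`, whose primes are
`≥ P_n > u`). [cite: Shiu1980, §5] -/
theorem dvd_and_sifted_of_cPart_eq {g : ℤ[X]} {n : ℕ} {z u : ℝ} {c : ℕ}
    (hm0 : (g.eval (n : ℤ)).natAbs ≠ 0) (hc : Shiu.cPart z (g.eval (n : ℤ)).natAbs = c)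
    (hu : u < (Shiu.cutPrime z (g.eval (n : ℤ)).natAbs : ℝ)) :
    (c : ℤ) ∣ g.eval (n : ℤ) ∧
      ∀ p ∈ Nat.primesBelow ⌈u⌉₊, ¬ p ∣ c → ¬ (p : ℤ) ∣ g.eval (n : ℤ) := by
  set m := (g.eval (n : ℤ)).natAbs with hm
  have hcm : c ∣ m := hc ▸ Shiu.cPart_dvd hm0
  refine ⟨Int.natCast_dvd.2 hcm, fun p hp hpc hpg => ?_⟩
  obtain ⟨hpu, hpp⟩ := Nat.mem_primesBelow.1 hp
  have hpu' : (p : ℝ) < u := Nat.lt_ceil.1 hpu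
  have hpm : p ∣ m := Int.natCast_dvd.1 hpg
  have hpd : p ∣ Shiu.dPart z m := by
    rw [← Shiu.cPart_mul_dPart (z := z) hm0, hc] at hpm
    exact (hpp.dvd_mul.1 hpm).resolve_left hpc
  have hmem : p ∈ (Shiu.dPart z m).primeFactors :=
    Nat.mem_primeFactors.2 ⟨hpp, hpd, Shiu.dPart_ne_zero hm0⟩
  have h1 := Shiu.cutPrime_le_of_mem_primeFactors_dPart hm0 hmem
  have h2 : (Shiu.cutPrime z m : ℝ) ≤ p := by exact_mod_cast h1
  linarith

/-- `∏_{p ∣ c} (1 − ρ_g(p)/p)⁻¹ ≥ 1` (every factor is `≥ 1`). [folklore] -/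
theorem one_le_prod_inv_one_sub_rho {g : ℤ[X]} (hg : HasNoFixedPrimeDivisor ![g]) (c : ℕ) :
    1 ≤ ∏ p ∈ c.primeFactors, (1 - (polyRootCountMod ![g] p : ℝ) / p)⁻¹ := by
  calc (1 : ℝ) = ∏ p ∈ c.primeFactors, (1 : ℝ) := prod_const_one.symm
    _ ≤ ∏ p ∈ c.primeFactors, (1 - (polyRootCountMod ![g] p : ℝ) / p)⁻¹ :=
        prod_le_prod (fun _ _ => zero_le_one) fun p hp => by
          have hpp := Nat.prime_of_mem_primeFactors hp
          rw [one_le_inv₀ (one_sub_rho_div_pos hg hpp)]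
          have : 0 ≤ (polyRootCountMod ![g] p : ℝ) / p := by positivity
          linarith

/-! ### Class I: the cut prime exceeds `w` -/

/-- **Class I** (the polynomial analogue of Shiu 1980, §5, `∑_I`).  Let `ρ_g(p) ≤ D`, `ρ_g(p) < p`,
`ρ_g(p^a) ≤ W` (`W ≥ 1`) at every prime.  There is `K = K(g) > 0` such that for all `N`, `X`,
`z ≥ 1`, `w ≥ 2`, `M` with `|g(n)| ≤ X` on `[1, N]` and `log X / log w ≤ M`:
`∑_{n ≤ N, |g(n)| > z, P_n > w} τ(|g(n)|) ≤ 2^M · K · ((N + z) ∏_{p<w}(1 − ρ_g(p)/p) + w² z) · (∏_{p ≤ ⌊z⌋}(1 − ρ_g(p)/p))⁻²`.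
Proof: group by `c = c_n ≤ z`; `τ(|g(n)|) = τ(c)τ(d_n) ≤ τ(c) 2^M`; the `n` over `c` are in the sifted
polynomial progression of `polySegment_sieve_bound'` at level `w`; sum the weights with
`exists_weightSum_le`. [cite: Shiu1980, §5 (∑_I)]; [cite: Erdos1952]; [this work] -/
theorem polyClassI_bound {g : ℤ[X]} (hg : HasNoFixedPrimeDivisor ![g]) {D : ℕ} {W : ℝ}
    (hD : ∀ p : ℕ, p.Prime → polyRootCountMod ![g] p ≤ D)
    (hW : ∀ p : ℕ, p.Prime → ∀ a : ℕ, (polyRootCountMod ![g] (p ^ a) : ℝ) ≤ W) (hW1 : 1 ≤ W) :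
    ∃ K : ℝ, 0 < K ∧ ∀ (N : ℕ) (X z w : ℝ), 1 ≤ z → 2 ≤ w →
      (∀ n ∈ Icc 1 N, (((g.eval (n : ℤ)).natAbs : ℕ) : ℝ) ≤ X) →
      ∀ (M : ℕ), Real.log X / Real.log w ≤ M →
        ∑ n ∈ (Icc 1 N).filter (fun n : ℕ => z < (((g.eval (n : ℤ)).natAbs : ℕ) : ℝ) ∧
            w < (Shiu.cutPrime z (g.eval (n : ℤ)).natAbs : ℝ)),
            (#((g.eval (n : ℤ)).natAbs.divisors) : ℝ) ≤
          2 ^ M * K * (((N : ℝ) + z) * (∏ p ∈ Nat.primesBelow ⌈w⌉₊,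
              (1 - (polyRootCountMod ![g] p : ℝ) / p)) + w ^ 2 * z) *
            ((∏ p ∈ Nat.primesLE ⌊z⌋₊, (1 - (polyRootCountMod ![g] p : ℝ) / p)) ^ 2)⁻¹ := by
  classical
  obtain ⟨C, hC, hseg⟩ := polySegment_sieve_bound' D
  obtain ⟨K, hK, hsum⟩ := exists_weightSum_le hg hD hW hW1
  refine ⟨C * K, mul_pos hC hK, fun N X z w hz1 hw hX M hM => ?_⟩
  -- notation
  set ρ : ℕ → ℝ := fun c => (polyRootCountMod ![g] c : ℝ) with hρ
  set E : ℕ → ℝ := fun c => ∏ p ∈ c.primeFactors, (1 - (polyRootCountMod ![g] p : ℝ) / p)⁻¹ with hE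
  set Pw : ℝ := ∏ p ∈ Nat.primesBelow ⌈w⌉₊, (1 - (polyRootCountMod ![g] p : ℝ) / p) with hPw
  set Pz : ℝ := ∏ p ∈ Nat.primesLE ⌊z⌋₊, (1 - (polyRootCountMod ![g] p : ℝ) / p) with hPz
  set T := (Icc 1 N).filter (fun n : ℕ => z < (((g.eval (n : ℤ)).natAbs : ℕ) : ℝ) ∧
      w < (Shiu.cutPrime z (g.eval (n : ℤ)).natAbs : ℝ)) with hT
  set Cz := Icc 1 ⌊z⌋₊ with hCz
  have hw1 : (1 : ℝ) < w := by linarith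
  have hw0 : (0 : ℝ) ≤ w := by linarith
  have hz0 : 0 ≤ z := by linarith
  have h2M : (0 : ℝ) ≤ 2 ^ M := by positivity
  have hPw0 : 0 ≤ Pw := prod_nonneg fun p hp =>
    (one_sub_rho_div_pos hg (Nat.mem_primesBelow.1 hp).2).le
  -- facts about `n ∈ T`
  have hTmem : ∀ n ∈ T, n ∈ Icc 1 N ∧ z < (((g.eval (n : ℤ)).natAbs : ℕ) : ℝ) ∧
      w < (Shiu.cutPrime z (g.eval (n : ℤ)).natAbs : ℝ) := fun n hn => by
    simpa only [hT, mem_filter, and_assoc] using hn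
  have hm2 : ∀ n ∈ T, 2 ≤ (g.eval (n : ℤ)).natAbs := fun n hn =>
    two_le_natAbs_of_lt hz1 (hTmem n hn).2.1
  have hm0 : ∀ n ∈ T, (g.eval (n : ℤ)).natAbs ≠ 0 := fun n hn => by have := hm2 n hn; omega
  -- the fibre map `n ↦ c_n`
  have hmaps : ∀ n ∈ T, Shiu.cPart z (g.eval (n : ℤ)).natAbs ∈ Cz := by
    intro n hn
    rw [hCz, mem_Icc]
    exact ⟨Nat.one_le_iff_ne_zero.2 Shiu.cPart_ne_zero,
      Nat.le_floor (Shiu.cutPrime_mem (hm2 n hn) hz1).2⟩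
  rw [← sum_fiberwise_of_maps_to hmaps]
  -- the inner sums
  have hinner : ∀ c ∈ Cz,
      ∑ n ∈ T.filter (fun n : ℕ => Shiu.cPart z (g.eval (n : ℤ)).natAbs = c),
        (#((g.eval (n : ℤ)).natAbs.divisors) : ℝ) ≤
      (#c.divisors : ℝ) * 2 ^ M * (C * ρ c * (((N : ℝ) / c + 1) * (Pw * E c) + w ^ 2)) := by
    intro c hc
    rw [hCz, mem_Icc] at hc
    obtain ⟨hc1, hcz⟩ := hc
    have hc0 : 0 < c := hc1
    set Tc := T.filter (fun n : ℕ => Shiu.cPart z (g.eval (n : ℤ)).natAbs = c) with hTc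
    set Sc := (Icc 1 N).filter (fun n : ℕ => (c : ℤ) ∣ g.eval (n : ℤ) ∧
      ∀ p ∈ Nat.primesBelow ⌈w⌉₊, ¬ p ∣ c → ¬ (p : ℤ) ∣ g.eval (n : ℤ)) with hSc
    have hTc_mem : ∀ n ∈ Tc, n ∈ T ∧ Shiu.cPart z (g.eval (n : ℤ)).natAbs = c := fun n hn =>
      mem_filter.1 hn
    -- pointwise: `τ(m) = τ(c) τ(d) ≤ τ(c) 2^M`
    have hpt : ∀ n ∈ Tc, (#((g.eval (n : ℤ)).natAbs.divisors) : ℝ) ≤ (#c.divisors : ℝ) * 2 ^ M := by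
      intro n hn
      obtain ⟨hnT, hcn⟩ := hTc_mem n hn
      have h0 := hm0 n hnT
      set m := (g.eval (n : ℤ)).natAbs with hm
      have hsplit : (#m.divisors : ℝ) = #c.divisors * #(Shiu.dPart z m).divisors := by
        conv_lhs => rw [← Shiu.cPart_mul_dPart (z := z) h0]
        rw [Nat.Coprime.card_divisors_mul (Shiu.coprime_cPart_dPart h0), hcn, Nat.cast_mul]
      rw [hsplit]
      refine mul_le_mul_of_nonneg_left ?_ (Nat.cast_nonneg _)
      have hd0 : Shiu.dPart z m ≠ 0 := Shiu.dPart_ne_zero h0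
      have hprimes : ∀ p ∈ (Shiu.dPart z m).primeFactors, w ≤ (p : ℝ) := by
        intro p hp
        have h1 := Shiu.cutPrime_le_of_mem_primeFactors_dPart h0 hp
        have h2 : (Shiu.cutPrime z m : ℝ) ≤ p := by exact_mod_cast h1
        linarith [(hTmem n hnT).2.2]
      have hdX : ((Shiu.dPart z m : ℕ) : ℝ) ≤ X := by
        have h1 : (Shiu.dPart z m : ℝ) ≤ m := by exact_mod_cast Nat.div_le_self m _
        exact h1.trans (hX n (hTmem n hnT).1)
      exact card_divisors_le_two_pow_of_rough hd0 hw1 hprimes hdX hM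
    -- the fibre lies in the sifted polynomial progression
    have hsub : Tc ⊆ Sc := by
      intro n hn
      obtain ⟨hnT, hcn⟩ := hTc_mem n hn
      rw [hSc, mem_filter]
      exact ⟨(hTmem n hnT).1, dvd_and_sifted_of_cPart_eq (hm0 n hnT) hcn (hTmem n hnT).2.2⟩
    have hcard : (#Tc : ℝ) ≤ C * ρ c * (((N : ℝ) / c + 1) * (Pw * E c) + w ^ 2) :=
      le_trans (by exact_mod_cast card_le_card hsub) (hseg g hD hg c hc0 N w hw)
    have hτ0 : (0 : ℝ) ≤ (#c.divisors : ℝ) * 2 ^ M := by positivity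
    calc ∑ n ∈ Tc, (#((g.eval (n : ℤ)).natAbs.divisors) : ℝ)
        ≤ ∑ n ∈ Tc, (#c.divisors : ℝ) * 2 ^ M := sum_le_sum hpt
      _ = #Tc * ((#c.divisors : ℝ) * 2 ^ M) := by rw [sum_const, nsmul_eq_mul]
      _ ≤ (C * ρ c * (((N : ℝ) / c + 1) * (Pw * E c) + w ^ 2)) * ((#c.divisors : ℝ) * 2 ^ M) :=
          mul_le_mul_of_nonneg_right hcard hτ0
      _ = _ := by ring
  -- per `c`: bring it to the weight `h_g(c)/c`
  have hstep : ∀ c ∈ Cz,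
      (#c.divisors : ℝ) * 2 ^ M * (C * ρ c * (((N : ℝ) / c + 1) * (Pw * E c) + w ^ 2)) ≤
      2 ^ M * C * (((N : ℝ) + z) * Pw + w ^ 2 * z) * ((#c.divisors : ℝ) * ρ c * E c / c) := by
    intro c hc
    rw [hCz, mem_Icc] at hc
    obtain ⟨hc1, hcz⟩ := hc
    have hc0' : (0 : ℝ) < c := by exact_mod_cast hc1
    have hcz' : (c : ℝ) ≤ z := (Nat.le_floor_iff hz0).1 hcz
    have hE1 : 1 ≤ E c := one_le_prod_inv_one_sub_rho hg c
    have hρ0 : 0 ≤ ρ c := Nat.cast_nonneg _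
    have hτ0 : (0 : ℝ) ≤ #c.divisors := Nat.cast_nonneg _
    set τ : ℝ := (#c.divisors : ℝ) with hτ
    set h : ℝ := τ * ρ c * E c / c with hh
    have hh0 : 0 ≤ h := div_nonneg (by positivity) hc0'.le
    have hτρE : τ * ρ c * E c = h * c := by rw [hh, div_mul_cancel₀ _ hc0'.ne']
    have hNc : ((N : ℝ) / c + 1) * c = N + c := by field_simp
    have hLHS : τ * 2 ^ M * (C * ρ c * (((N : ℝ) / c + 1) * (Pw * E c) + w ^ 2)) =
        2 ^ M * C * (((N : ℝ) + c) * Pw * h + τ * ρ c * w ^ 2) := by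
      calc τ * 2 ^ M * (C * ρ c * (((N : ℝ) / c + 1) * (Pw * E c) + w ^ 2))
          = 2 ^ M * C * (((N : ℝ) / c + 1) * Pw * (τ * ρ c * E c) + τ * ρ c * w ^ 2) := by ring
        _ = 2 ^ M * C * (((N : ℝ) / c + 1) * Pw * (h * c) + τ * ρ c * w ^ 2) := by rw [hτρE]
        _ = 2 ^ M * C * ((((N : ℝ) / c + 1) * c) * Pw * h + τ * ρ c * w ^ 2) := by ring
        _ = 2 ^ M * C * (((N : ℝ) + c) * Pw * h + τ * ρ c * w ^ 2) := by rw [hNc]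
    have hb1 : ((N : ℝ) + c) * Pw * h ≤ ((N : ℝ) + z) * Pw * h :=
      mul_le_mul_of_nonneg_right (mul_le_mul_of_nonneg_right (by linarith) hPw0) hh0
    have hb2 : τ * ρ c * w ^ 2 ≤ w ^ 2 * z * h := by
      calc τ * ρ c * w ^ 2 ≤ τ * ρ c * w ^ 2 * E c :=
            le_mul_of_one_le_right (mul_nonneg (mul_nonneg hτ0 hρ0) (pow_nonneg hw0 2)) hE1
        _ = w ^ 2 * (τ * ρ c * E c) := by ring
        _ = w ^ 2 * (h * c) := by rw [hτρE]
        _ = w ^ 2 * c * h := by ring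
        _ ≤ w ^ 2 * z * h :=
            mul_le_mul_of_nonneg_right (mul_le_mul_of_nonneg_left hcz' (by positivity)) hh0
    have hC2 : (0 : ℝ) ≤ 2 ^ M * C := by positivity
    rw [hLHS]
    calc 2 ^ M * C * (((N : ℝ) + c) * Pw * h + τ * ρ c * w ^ 2)
        ≤ 2 ^ M * C * (((N : ℝ) + z) * Pw * h + w ^ 2 * z * h) :=
          mul_le_mul_of_nonneg_left (add_le_add hb1 hb2) hC2
      _ = 2 ^ M * C * (((N : ℝ) + z) * Pw + w ^ 2 * z) * h := by ring
  -- the weight sum over `c ≤ ⌊z⌋`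
  have hv2 : (2 : ℝ) ≤ (⌊z⌋₊ : ℝ) + 1 := by
    have : (1 : ℝ) ≤ (⌊z⌋₊ : ℝ) := by exact_mod_cast Nat.le_floor (by simpa using hz1)
    linarith
  have hW := hsum ((⌊z⌋₊ : ℝ) + 1) hv2 Cz
    (fun c hc => by have := (mem_Icc.1 hc).1; omega)
    (fun c hc p hp => by
      have hcz : c ≤ ⌊z⌋₊ := (mem_Icc.1 hc).2
      have hpc : p ≤ c := Nat.le_of_mem_primeFactors hp
      have : ((p : ℕ) : ℝ) ≤ (⌊z⌋₊ : ℝ) := by exact_mod_cast hpc.trans hcz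
      linarith)
  have hceil : Nat.primesBelow ⌈(⌊z⌋₊ : ℝ) + 1⌉₊ = Nat.primesLE ⌊z⌋₊ := by
    rw [Nat.primesLE]
    congr 1
    exact_mod_cast Nat.ceil_natCast (⌊z⌋₊ + 1)
  rw [hceil] at hW
  have hcoef : 0 ≤ 2 ^ M * C * (((N : ℝ) + z) * Pw + w ^ 2 * z) := by positivity
  calc ∑ c ∈ Cz, ∑ n ∈ T.filter (fun n : ℕ => Shiu.cPart z (g.eval (n : ℤ)).natAbs = c),
        (#((g.eval (n : ℤ)).natAbs.divisors) : ℝ)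
      ≤ ∑ c ∈ Cz, (#c.divisors : ℝ) * 2 ^ M * (C * ρ c * (((N : ℝ) / c + 1) * (Pw * E c) + w ^ 2)) :=
        sum_le_sum hinner
    _ ≤ ∑ c ∈ Cz, 2 ^ M * C * (((N : ℝ) + z) * Pw + w ^ 2 * z) *
        ((#c.divisors : ℝ) * ρ c * E c / c) := sum_le_sum hstep
    _ = 2 ^ M * C * (((N : ℝ) + z) * Pw + w ^ 2 * z) *
        ∑ c ∈ Cz, (#c.divisors : ℝ) * ρ c * E c / c := by rw [mul_sum]
    _ ≤ 2 ^ M * C * (((N : ℝ) + z) * Pw + w ^ 2 * z) * (K * (Pz ^ 2)⁻¹) :=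
        mul_le_mul_of_nonneg_left hW hcoef
    _ = 2 ^ M * (C * K) * (((N : ℝ) + z) * Pw + w ^ 2 * z) * (Pz ^ 2)⁻¹ := by ring

end ErdosDivisor

end Summit.Parity.BatemanHorn.Theorems
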